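import Summits.QuantumFields.YangMills.Theorems.BalabanUVNodesN19TargetOfDecorrelationReading

/-!
# YM-DAG node N19 (= NE7 proper) — THE RESPONSE ROAD OVER INDEPENDENT BLOCKS: (RM) radii ADD and the decorrelation letter (DC) ADDS over a product of two
# independent class systems (class set `T₁ ×ˢ T₂`, weights multiplicative) — the response-road analogue of this seat's g2 `core_prod` ∕ g4 `…TVProductBlocks`:
# a torus cut into independently expanded regions pays `Σ_b (r_b + κ_b)`

Cell `pub-ymgap`, HUMAN RULING D-0062 (Track A), width seat `pub-ymgap-dag-n19-w2` (node n19 = NE7), generation g7 (R455 (A) rule (ii); CLAIM-10 on the cell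
bus).  Route `Summits/QuantumFields/YangMills/Theses/BalabanUVNodes.lean`, key item K3⁸ `SpineGivenEndpointR13SepCoPHV` (stmt-QuantumFields-27366; aside
predecessor K3⁷ 20544); filed `--kind proof --supports … --as helper`.  COUNT-NEUTRAL.  THEOREMS ONLY (0 `def`, 0 `sorry`).  ADDITIVE — imports this seat's FILE C
`…N19TargetOfDecorrelationReading` (p625854) only; modifies nothing.

WHY.  This seat's g2∕g4∕g6 files gave the BLOCK calculus of the `Core` ∕ TV ∕ SHAPE currencies (radii add over independent blocks, `core_prod`, `core_pi`,
`abs_pi_real_sub_pi_real_le_sum_of_tv`, `tensor_two_rows_le_exp_sum_tanh_mul`).  The response road of g7 (FILE C: `Target ⇐ (RM) + (DC)`) has the same calculus: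
for two INDEPENDENT class systems (class set `T₁ ×ˢ T₂`, run-A and run-B weights MULTIPLICATIVE over the factors at every source value) the per-class response
matching radii ADD (`r₁ + r₂`, §1) and — because all four sums in the (DC)-expression FACTOR — the decorrelation expression of the product IS THE SUM of the
factors' expressions (§2, an identity), so `κ = κ₁ + κ₂`; along `K` the product reading meets node U5's target with `Σ_K (r₁ + r₂ + κ₁ + κ₂)_K < ∞` (§3).  Reading:
independently expanded regions of the torus (or independent species of structure) are booked additively by the road, exactly as by `Core`.

WHAT IS KERNEL-CHECKED ([folklore] finite sums).
* §1 `responseMatching_prod` — `|Δ₁| ≤ r₁`, `|Δ₂| ≤ r₂` for the factors' response-matching defects ⇒ the product class `(τ₁, τ₂)` has defect `≤ r₁ + r₂` (logs add).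
* §2 `sum_product_mul_eq` (`Σ_{T₁×T₂} f(τ₁)g(τ₂) = (Σ f)(Σ g)`) · ★★ `decorrelationExpr_prod_eq_add` (the (DC)-expression of the product weights EQUALS the sum of the
  factors' (DC)-expressions — positivity only) · ★ `decorrelation_prod` (`κ = κ₁ + κ₂`).
* §3 ★ `target_of_productReading` — along `K`, two factor readings with (RM)_b, (DC)_b and the product dictionary ⇒ `NE7.Target vol l₀ δ Z` with
  `r₁ + r₂ + κ₁ + κ₂ ≤ vol·δ_K` (FILE C's `target_of_responseDecorrelationReading` BY NAME at `T₁ K ×ˢ T₂ K`).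

HONEST FRAMING.  Finite-sum identities ∕ inequalities on hypothesis SHAPES (independent blocks with multiplicative weights — Bałaban's history weights do NOT
factor over regions; the product structure is a caricature, as in g2∕g4); nothing of Bałaban's instantiated; NE7 NOT PRINTED for d = 4 ∕ NOT proved; N19 NOT
discharged; K3⁸ 27366 OPEN, not claimed; counts UNMOVED (typed 28∕28 · discharged 5∕27, A 5∕28); no count claim.  One finite four-torus programme at fixed ε; R4 closes the
conditional finite-𝕋⁴ rung `BalabanLadder.UV` only — NOT the Yang–Mills mass gap, NOT the Clay problem.  0 `def`; 0 `sorry`; standard axioms.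
-/

noncomputable section

open Finset
open scoped BigOperators

namespace Summit.QuantumFields.YangMills.BalabanUVNodes.N19ResponseRoadProductBlocks

open Summit.QuantumFields.BalabanUV.T4Continuum.Spine
open Summit.QuantumFields.YangMills.BalabanUVNodes.N19TargetOfDecorrelationReading (target_of_responseDecorrelationReading)

variable {ι₁ ι₂ : Type*}

/-! ## §1 Response-matching radii add over a product -/

/-- **(RM) OVER A PRODUCT.**  If the factor classes have response-matching defects `|(log b₁ᵗ − log b₁⁰) − (log a₁ᵗ − log a₁⁰)| ≤ r₁` and `… ≤ r₂`, the product class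
(weights `a₁a₂`, `b₁b₂`, all positive) has defect `≤ r₁ + r₂`. [folklore] -/
theorem responseMatching_prod {a1t a10 b1t b10 a2t a20 b2t b20 r₁ r₂ : ℝ} (ha1t : 0 < a1t) (ha10 : 0 < a10) (hb1t : 0 < b1t) (hb10 : 0 < b10)
    (ha2t : 0 < a2t) (ha20 : 0 < a20) (hb2t : 0 < b2t) (hb20 : 0 < b20)
    (h₁ : |(Real.log b1t - Real.log b10) - (Real.log a1t - Real.log a10)| ≤ r₁)
    (h₂ : |(Real.log b2t - Real.log b20) - (Real.log a2t - Real.log a20)| ≤ r₂) :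
    |(Real.log (b1t * b2t) - Real.log (b10 * b20)) - (Real.log (a1t * a2t) - Real.log (a10 * a20))| ≤ r₁ + r₂ := by
  rw [Real.log_mul hb1t.ne' hb2t.ne', Real.log_mul hb10.ne' hb20.ne', Real.log_mul ha1t.ne' ha2t.ne', Real.log_mul ha10.ne' ha20.ne']
  have e : Real.log b1t + Real.log b2t - (Real.log b10 + Real.log b20) - (Real.log a1t + Real.log a2t - (Real.log a10 + Real.log a20)) =
      ((Real.log b1t - Real.log b10) - (Real.log a1t - Real.log a10)) + ((Real.log b2t - Real.log b20) - (Real.log a2t - Real.log a20)) := by ring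
  rw [e]
  exact (abs_add_le _ _).trans (add_le_add h₁ h₂)

/-! ## §2 The decorrelation expression of a product is the sum of the factors' expressions -/

/-- `Σ_{(τ₁,τ₂) ∈ T₁ ×ˢ T₂} f τ₁ · g τ₂ = (Σ_{T₁} f)(Σ_{T₂} g)`. [folklore] -/
theorem sum_product_mul_eq (T₁ : Finset ι₁) (T₂ : Finset ι₂) (f : ι₁ → ℝ) (g : ι₂ → ℝ) :
    ∑ τ ∈ T₁ ×ˢ T₂, f τ.1 * g τ.2 = (∑ τ₁ ∈ T₁, f τ₁) * ∑ τ₂ ∈ T₂, g τ₂ := by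
  rw [Finset.sum_product, Finset.sum_mul]
  exact Finset.sum_congr rfl fun τ₁ _ => by rw [Finset.mul_sum]

variable {T₁ : Finset ι₁} {T₂ : Finset ι₂} {A₁ B₁ : ℝ → ι₁ → ℝ} {A₂ B₂ : ℝ → ι₂ → ℝ} {A B : ℝ → ι₁ × ι₂ → ℝ} {l₀ : ℝ}

/-- **THE (DC)-EXPRESSION OF A PRODUCT = THE SUM OF THE FACTORS' (DC)-EXPRESSIONS** (an identity; positivity only).  Product weights `A_s(τ₁,τ₂) = A₁_s τ₁ · A₂_s τ₂`,
`B_0 = B₁_0 ⊗ B₂_0`: every sum in FILE C's displayed (DC)-expression factors (`sum_product_mul_eq`), and the logarithms add. [folklore] -/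
theorem decorrelationExpr_prod_eq_add (hT₁ : T₁.Nonempty) (hT₂ : T₂.Nonempty)
    (hA₁ : ∀ s, |s| ≤ l₀ → ∀ τ ∈ T₁, 0 < A₁ s τ) (hA₂ : ∀ s, |s| ≤ l₀ → ∀ τ ∈ T₂, 0 < A₂ s τ) (hB₁ : ∀ τ ∈ T₁, 0 < B₁ 0 τ) (hB₂ : ∀ τ ∈ T₂, 0 < B₂ 0 τ)
    (hl₀ : 0 ≤ l₀) (hA : ∀ s (τ : ι₁ × ι₂), τ ∈ T₁ ×ˢ T₂ → A s τ = A₁ s τ.1 * A₂ s τ.2) (hB : ∀ τ : ι₁ × ι₂, τ ∈ T₁ ×ˢ T₂ → B 0 τ = B₁ 0 τ.1 * B₂ 0 τ.2)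
    {t : ℝ} (ht : |t| ≤ l₀) :
    Real.log (∑ τ ∈ T₁ ×ˢ T₂, B 0 τ * (A t τ / A 0 τ)) - Real.log (∑ τ ∈ T₁ ×ˢ T₂, B 0 τ) -
        (Real.log (∑ τ ∈ T₁ ×ˢ T₂, A t τ) - Real.log (∑ τ ∈ T₁ ×ˢ T₂, A 0 τ)) =
      (Real.log (∑ τ ∈ T₁, B₁ 0 τ * (A₁ t τ / A₁ 0 τ)) - Real.log (∑ τ ∈ T₁, B₁ 0 τ) - (Real.log (∑ τ ∈ T₁, A₁ t τ) - Real.log (∑ τ ∈ T₁, A₁ 0 τ))) +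
      (Real.log (∑ τ ∈ T₂, B₂ 0 τ * (A₂ t τ / A₂ 0 τ)) - Real.log (∑ τ ∈ T₂, B₂ 0 τ) - (Real.log (∑ τ ∈ T₂, A₂ t τ) - Real.log (∑ τ ∈ T₂, A₂ 0 τ))) := by
  have h0 : |(0 : ℝ)| ≤ l₀ := by simpa using hl₀
  -- factor the four sums
  have eS : ∑ τ ∈ T₁ ×ˢ T₂, B 0 τ * (A t τ / A 0 τ) =
      (∑ τ ∈ T₁, B₁ 0 τ * (A₁ t τ / A₁ 0 τ)) * ∑ τ ∈ T₂, B₂ 0 τ * (A₂ t τ / A₂ 0 τ) := by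
    rw [← sum_product_mul_eq]
    refine Finset.sum_congr rfl fun τ hτ => ?_
    obtain ⟨h1, h2⟩ := Finset.mem_product.1 hτ
    rw [hB τ hτ, hA t τ hτ, hA 0 τ hτ]
    have := (hA₁ 0 h0 τ.1 h1).ne'
    have := (hA₂ 0 h0 τ.2 h2).ne'
    field_simp
  have eB : ∑ τ ∈ T₁ ×ˢ T₂, B 0 τ = (∑ τ ∈ T₁, B₁ 0 τ) * ∑ τ ∈ T₂, B₂ 0 τ := by
    rw [← sum_product_mul_eq]; exact Finset.sum_congr rfl fun τ hτ => hB τ hτ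
  have eAt : ∑ τ ∈ T₁ ×ˢ T₂, A t τ = (∑ τ ∈ T₁, A₁ t τ) * ∑ τ ∈ T₂, A₂ t τ := by
    rw [← sum_product_mul_eq]; exact Finset.sum_congr rfl fun τ hτ => hA t τ hτ
  have eA0 : ∑ τ ∈ T₁ ×ˢ T₂, A 0 τ = (∑ τ ∈ T₁, A₁ 0 τ) * ∑ τ ∈ T₂, A₂ 0 τ := by
    rw [← sum_product_mul_eq]; exact Finset.sum_congr rfl fun τ hτ => hA 0 τ hτ
  -- positivity of the factor sums
  have pS1 : 0 < ∑ τ ∈ T₁, B₁ 0 τ * (A₁ t τ / A₁ 0 τ) :=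
    Finset.sum_pos (fun τ hτ => mul_pos (hB₁ τ hτ) (div_pos (hA₁ t ht τ hτ) (hA₁ 0 h0 τ hτ))) hT₁
  have pS2 : 0 < ∑ τ ∈ T₂, B₂ 0 τ * (A₂ t τ / A₂ 0 τ) :=
    Finset.sum_pos (fun τ hτ => mul_pos (hB₂ τ hτ) (div_pos (hA₂ t ht τ hτ) (hA₂ 0 h0 τ hτ))) hT₂
  have pB1 : 0 < ∑ τ ∈ T₁, B₁ 0 τ := Finset.sum_pos hB₁ hT₁
  have pB2 : 0 < ∑ τ ∈ T₂, B₂ 0 τ := Finset.sum_pos hB₂ hT₂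
  have pAt1 : 0 < ∑ τ ∈ T₁, A₁ t τ := Finset.sum_pos (fun τ hτ => hA₁ t ht τ hτ) hT₁
  have pAt2 : 0 < ∑ τ ∈ T₂, A₂ t τ := Finset.sum_pos (fun τ hτ => hA₂ t ht τ hτ) hT₂
  have pA01 : 0 < ∑ τ ∈ T₁, A₁ 0 τ := Finset.sum_pos (fun τ hτ => hA₁ 0 h0 τ hτ) hT₁
  have pA02 : 0 < ∑ τ ∈ T₂, A₂ 0 τ := Finset.sum_pos (fun τ hτ => hA₂ 0 h0 τ hτ) hT₂
  rw [eS, eB, eAt, eA0, Real.log_mul pS1.ne' pS2.ne', Real.log_mul pB1.ne' pB2.ne', Real.log_mul pAt1.ne' pAt2.ne', Real.log_mul pA01.ne' pA02.ne']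
  ring

/-- **(DC) OVER A PRODUCT**: `κ = κ₁ + κ₂`. [folklore] -/
theorem decorrelation_prod (hT₁ : T₁.Nonempty) (hT₂ : T₂.Nonempty)
    (hA₁ : ∀ s, |s| ≤ l₀ → ∀ τ ∈ T₁, 0 < A₁ s τ) (hA₂ : ∀ s, |s| ≤ l₀ → ∀ τ ∈ T₂, 0 < A₂ s τ) (hB₁ : ∀ τ ∈ T₁, 0 < B₁ 0 τ) (hB₂ : ∀ τ ∈ T₂, 0 < B₂ 0 τ)
    (hl₀ : 0 ≤ l₀) (hA : ∀ s (τ : ι₁ × ι₂), τ ∈ T₁ ×ˢ T₂ → A s τ = A₁ s τ.1 * A₂ s τ.2) (hB : ∀ τ : ι₁ × ι₂, τ ∈ T₁ ×ˢ T₂ → B 0 τ = B₁ 0 τ.1 * B₂ 0 τ.2)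
    {κ₁ κ₂ t : ℝ} (ht : |t| ≤ l₀)
    (hDC₁ : |Real.log (∑ τ ∈ T₁, B₁ 0 τ * (A₁ t τ / A₁ 0 τ)) - Real.log (∑ τ ∈ T₁, B₁ 0 τ) -
        (Real.log (∑ τ ∈ T₁, A₁ t τ) - Real.log (∑ τ ∈ T₁, A₁ 0 τ))| ≤ κ₁)
    (hDC₂ : |Real.log (∑ τ ∈ T₂, B₂ 0 τ * (A₂ t τ / A₂ 0 τ)) - Real.log (∑ τ ∈ T₂, B₂ 0 τ) -
        (Real.log (∑ τ ∈ T₂, A₂ t τ) - Real.log (∑ τ ∈ T₂, A₂ 0 τ))| ≤ κ₂) :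
    |Real.log (∑ τ ∈ T₁ ×ˢ T₂, B 0 τ * (A t τ / A 0 τ)) - Real.log (∑ τ ∈ T₁ ×ˢ T₂, B 0 τ) -
        (Real.log (∑ τ ∈ T₁ ×ˢ T₂, A t τ) - Real.log (∑ τ ∈ T₁ ×ˢ T₂, A 0 τ))| ≤ κ₁ + κ₂ := by
  rw [decorrelationExpr_prod_eq_add hT₁ hT₂ hA₁ hA₂ hB₁ hB₂ hl₀ hA hB ht]
  exact (abs_add_le _ _).trans (add_le_add hDC₁ hDC₂)

/-! ## §3 Along `K`: two independent factor readings ⇒ node U5's `Target` with the budgets added -/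

/-- **`Target` FROM A PRODUCT READING.**  Along `K`: factor class sets `T₁ K`, `T₂ K` (nonempty), positive factor weights, the product dictionary
`Z K t = Σ_{T₁ K ×ˢ T₂ K} A₁ ⊗ A₂`, `Z (K+1) t = Σ B₁ ⊗ B₂`, per-factor (RM)_b with `r_b K` and (DC)_b with `κ_b K`, and `r₁ + r₂ + κ₁ + κ₂ ≤ vol·δ_K`, `Summable δ` ⇒
`NE7.Target vol l₀ δ Z`. [folklore] -/
theorem target_of_productReading {vol l₀ : ℝ} {δ : ℕ → ℝ} {Z : ℕ → ℝ → ℝ} (hl₀ : 0 ≤ l₀) (T₁ : ℕ → Finset ι₁) (T₂ : ℕ → Finset ι₂)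
    (A₁ B₁ : ℕ → ℝ → ι₁ → ℝ) (A₂ B₂ : ℕ → ℝ → ι₂ → ℝ) (r₁ r₂ κ₁ κ₂ : ℕ → ℝ)
    (hT₁ : ∀ K, (T₁ K).Nonempty) (hT₂ : ∀ K, (T₂ K).Nonempty)
    (hA₁ : ∀ K s, |s| ≤ l₀ → ∀ τ ∈ T₁ K, 0 < A₁ K s τ) (hA₂ : ∀ K s, |s| ≤ l₀ → ∀ τ ∈ T₂ K, 0 < A₂ K s τ)
    (hB₁ : ∀ K s, |s| ≤ l₀ → ∀ τ ∈ T₁ K, 0 < B₁ K s τ) (hB₂ : ∀ K s, |s| ≤ l₀ → ∀ τ ∈ T₂ K, 0 < B₂ K s τ)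
    (hRM₁ : ∀ K t, |t| ≤ l₀ → ∀ τ ∈ T₁ K,
      |(Real.log (B₁ K t τ) - Real.log (B₁ K 0 τ)) - (Real.log (A₁ K t τ) - Real.log (A₁ K 0 τ))| ≤ r₁ K)
    (hRM₂ : ∀ K t, |t| ≤ l₀ → ∀ τ ∈ T₂ K,
      |(Real.log (B₂ K t τ) - Real.log (B₂ K 0 τ)) - (Real.log (A₂ K t τ) - Real.log (A₂ K 0 τ))| ≤ r₂ K)
    (hDC₁ : ∀ K t, |t| ≤ l₀ → |Real.log (∑ τ ∈ T₁ K, B₁ K 0 τ * (A₁ K t τ / A₁ K 0 τ)) - Real.log (∑ τ ∈ T₁ K, B₁ K 0 τ) -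
        (Real.log (∑ τ ∈ T₁ K, A₁ K t τ) - Real.log (∑ τ ∈ T₁ K, A₁ K 0 τ))| ≤ κ₁ K)
    (hDC₂ : ∀ K t, |t| ≤ l₀ → |Real.log (∑ τ ∈ T₂ K, B₂ K 0 τ * (A₂ K t τ / A₂ K 0 τ)) - Real.log (∑ τ ∈ T₂ K, B₂ K 0 τ) -
        (Real.log (∑ τ ∈ T₂ K, A₂ K t τ) - Real.log (∑ τ ∈ T₂ K, A₂ K 0 τ))| ≤ κ₂ K)
    (hZA : ∀ K t, |t| ≤ l₀ → Z K t = ∑ τ ∈ T₁ K ×ˢ T₂ K, A₁ K t τ.1 * A₂ K t τ.2)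
    (hZB : ∀ K t, |t| ≤ l₀ → Z (K + 1) t = ∑ τ ∈ T₁ K ×ˢ T₂ K, B₁ K t τ.1 * B₂ K t τ.2)
    (hbud : ∀ K, r₁ K + r₂ K + κ₁ K + κ₂ K ≤ vol * δ K) (hδ : Summable δ) : NE7.Target vol l₀ δ Z := by
  have h0 : |(0 : ℝ)| ≤ l₀ := by simpa using hl₀
  refine target_of_responseDecorrelationReading hl₀ (fun K => T₁ K ×ˢ T₂ K) (fun K t τ => A₁ K t τ.1 * A₂ K t τ.2)
    (fun K t τ => B₁ K t τ.1 * B₂ K t τ.2) (fun K => r₁ K + r₂ K) (fun K => κ₁ K + κ₂ K)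
    (fun K => Finset.Nonempty.product (hT₁ K) (hT₂ K)) ?_ ?_ ?_ ?_ hZA hZB (fun K => by linarith [hbud K]) hδ
  · intro K t ht τ hτ
    obtain ⟨h1, h2⟩ := Finset.mem_product.1 hτ
    exact mul_pos (hA₁ K t ht _ h1) (hA₂ K t ht _ h2)
  · intro K t ht τ hτ
    obtain ⟨h1, h2⟩ := Finset.mem_product.1 hτ
    exact mul_pos (hB₁ K t ht _ h1) (hB₂ K t ht _ h2)
  · intro K t ht τ hτ
    obtain ⟨h1, h2⟩ := Finset.mem_product.1 hτ
    exact responseMatching_prod (hA₁ K t ht _ h1) (hA₁ K 0 h0 _ h1) (hB₁ K t ht _ h1) (hB₁ K 0 h0 _ h1) (hA₂ K t ht _ h2) (hA₂ K 0 h0 _ h2)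
      (hB₂ K t ht _ h2) (hB₂ K 0 h0 _ h2) (hRM₁ K t ht _ h1) (hRM₂ K t ht _ h2)
  · intro K t ht
    exact decorrelation_prod (A := fun s τ => A₁ K s τ.1 * A₂ K s τ.2) (B := fun s τ => B₁ K s τ.1 * B₂ K s τ.2) (hT₁ K) (hT₂ K) (hA₁ K) (hA₂ K)
      (fun τ hτ => hB₁ K 0 h0 τ hτ) (fun τ hτ => hB₂ K 0 h0 τ hτ) hl₀ (fun _ _ _ => rfl) (fun _ _ => rfl) ht (hDC₁ K t ht) (hDC₂ K t ht)

end Summit.QuantumFields.YangMills.BalabanUVNodes.N19ResponseRoadProductBlocks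

end
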